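import Summits.QuantumFields.Balaban3D.Proofs.InputsAC

/-!
# `Summit.QuantumFields.Balaban3D.Proofs.TowerFactsAC` — STRUCTURAL FACTS about the objects of the lane's AC tower `towerOfAC 𝔎 X 𝔖` as a
# `B10.TowerRun` (for the T³ bridge to the Literature interface `T3AlphaInputsAC`, lane `pub-balaban3d`, seat alpha-1, LINE 2 of
# `defn-AlphaInputsT3AC`): the main term IS `(1/g₀²)·Σ_p[1 − Re tr U_k(h,V)(∂p)]` (normalisation `(1/g_k²)·η^{−1} = 1/(g²ε)`), the
# characteristic function `χ_k` takes values in `[0, 1]`, the history functional `LFAC` is monotone on the SUPPORT of the masses, and the regions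
# of the trivial history are the whole torus.

All four are unfoldings of the spine's `SectB.TowerObjects.toTowerRun` / seat p1's `run3` / `TowerAC.towerWith` definitions; [folklore]
bookkeeping; nothing of [Balaban1985UV3] is asserted.
-/

noncomputable section

namespace Summit.QuantumFields.Balaban3D.Proofs.TowerFactsAC

open MeasureTheory
open Literature.MathematicalPhysics.QuantumFieldTheory.Balaban1983to89
open Literature.MathematicalPhysics.QuantumFieldTheory.Balaban1985CMP102
open Literature.MathematicalPhysics.QuantumFieldTheory.Balaban1985CMP102.Setting
open Summit.QuantumFields.Balaban3D.Carriers
open Summit.QuantumFields.Balaban3D.Proofs.ScalesArithmetic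
open Summit.QuantumFields.Balaban3D.Proofs.Inputs
open Summit.QuantumFields.Balaban3D.Proofs.TowerAC
open Summit.QuantumFields.Balaban3D.Proofs.StandardAC
open Summit.QuantumFields.Balaban3D.Proofs.InputsAC

variable {L : ℕ} (𝔎 : LaneConsts L) {S : Scales L} {G : Type} [GaugeGroup G] [MeasurableSpace G] [HaarData G]
  {V : Type} [NormedAddCommGroup V] [NormedSpace ℂ V]
  (X : ExternalInputsAC S G) (𝔖 : ∀ k, StepSeries S G V (nblkOf S 𝔎.carrier k) k)

omit [MeasurableSpace G] [HaarData G] in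
/-- `w·Σ_p[1 − Re tr] = w · A₄`: the weighted Wilson action is the weight times the unit-weight one. [folklore] -/
theorem wilsonAction_eq_mul_wilsonAction4 {P : Params} {j : ℕ} (w : ℝ) (U : GaugeField P j G) :
    wilsonAction w U = w * wilsonAction4 U := by
  unfold wilsonAction4 wilsonAction
  rw [Finset.mul_sum]
  refine Finset.sum_congr rfl fun p _ => ?_
  rw [one_mul]

/-- **THE MAIN TERM OF (41)/(47) IN THE LANE'S AC TOWER IS `(1/g₀²)·Σ_{p ⊂ T_η}[1 − Re tr U_k(h,V)(∂p)]`**: the spine's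
`(1/g_k²)·A^η(U_k(h,V))` with `A^η = Σ_p η^{−1}[1 − Re tr]`, `g_k² = g²Lᵏε`, `η = L^{−k}` — so `(1/g_k²)·η^{−1} = 1/(g²ε) = 1/g₀²` at EVERY level `k`
(p. 256 «g_k = g(Lᵏε)^{1/2}», «η = L^{−k}»). [cite: Balaban1985UV3, (5) p.256 + (41) p.266] -/
theorem mainT_towerOfAC_eq (k : ℕ) (h : Hist S.P k) (U : GaugeField S.P k G) :
    (towerOfAC 𝔎 X 𝔖).mainT k h U = (1 / S.g0sq) * wilsonAction4 (X.UkH k h U) := by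
  show (S.gk k)⁻¹ ^ 2 * S.actionEta k (X.UkH k h U) = _
  unfold Scales.actionEta
  rw [wilsonAction_eq_mul_wilsonAction4, ← mul_assoc]
  congr 1
  have hL : (0 : ℝ) < L := by exact_mod_cast (zero_lt_one.trans S.hL.2)
  have hLk : (0 : ℝ) < (L : ℝ) ^ k := pow_pos hL k
  have hgk : S.gk k ^ 2 = S.g ^ 2 * ((L : ℝ) ^ k * S.ε) := gk_sq S k
  have heta : S.eta k = ((L : ℝ)⁻¹) ^ k := rfl
  simp only [heta, inv_pow, inv_inv, hgk]
  unfold Scales.g0sq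
  have hg : S.g ≠ 0 := S.g_pos.ne'
  have hε : S.ε ≠ 0 := S.ε_pos.ne'
  field_simp

/-- **`χ_k ≤ 1`** in the lane's AC tower (the characteristic function (4): `Setup.chiSmall` takes the values `0` and `1`). [cite: Balaban1985UV3, (4) p.256] -/
theorem chi_towerOfAC_le_one (k : ℕ) (U : GaugeField S.P k G) : (towerOfAC 𝔎 X 𝔖).χ k U ≤ 1 := by
  show chiSmall Set.univ _ U ≤ 1
  unfold chiSmall
  split_ifs <;> norm_num

/-- `0 ≤ χ_k` in the lane's AC tower (the carrier's field `χ_nonneg`). [cite: Balaban1985UV3, (4) p.256] -/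
theorem chi_towerOfAC_nonneg (k : ℕ) (U : GaugeField S.P k G) : 0 ≤ (towerOfAC 𝔎 X 𝔖).χ k U :=
  (towerOfAC 𝔎 X 𝔖).χ_nonneg k U

/-- **THE HISTORY FUNCTIONAL IS MONOTONE ON THE SUPPORT OF THE MASSES**: if `Φ h ≤ Ψ h` for every history `h` with `mass_k(h, U) ≠ 0`, then
`LF_k(U)[Φ] ≤ LF_k(U)[Ψ]` — `LF_k(U)[Φ] = Σ_h mass_k(h,U)·exp Φ(h)` (`TowerAC.LFAC`) charges only the support (the (h,U)-admissibility of
the T³ interface's `LFShape`). [cite: Balaban1985UV3, (41) p.266] -/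
theorem lf_towerOfAC_mono_of_support (k : ℕ) (U : GaugeField S.P k G) (Φ Ψ : Hist S.P k → ℝ)
    (hle : ∀ h, (inputOfAC 𝔎 X 𝔖).W.mass k h U ≠ 0 → Φ h ≤ Ψ h) :
    (towerOfAC 𝔎 X 𝔖).LF k U Φ ≤ (towerOfAC 𝔎 X 𝔖).LF k U Ψ := by
  show LFAC (inputOfAC 𝔎 X 𝔖).W k U Φ ≤ LFAC (inputOfAC 𝔎 X 𝔖).W k U Ψ
  unfold LFAC
  refine Finset.sum_le_sum fun h _ => ?_
  by_cases hm : (inputOfAC 𝔎 X 𝔖).W.mass k h U = 0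
  · rw [hm, zero_mul, zero_mul]
  · exact mul_le_mul_of_nonneg_left (Real.exp_le_exp.mpr (hle h hm)) ((inputOfAC 𝔎 X 𝔖).W.mass_nonneg k h U)

/-- `LF_k(U)[Φ + t] = eᵗ·LF_k(U)[Φ]` in the lane's AC tower (the carrier's field `lf_shift`, = `TowerAC.lfAC_shift`). [cite: Balaban1985UV3, (41) p.266] -/
theorem lf_towerOfAC_shift (k : ℕ) (U : GaugeField S.P k G) (Φ : Hist S.P k → ℝ) (t : ℝ) :
    (towerOfAC 𝔎 X 𝔖).LF k U (fun h => Φ h + t) = Real.exp t * (towerOfAC 𝔎 X 𝔖).LF k U Φ :=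
  (towerOfAC 𝔎 X 𝔖).lf_shift k U Φ t

/-- The histories of the AC tower ARE the carrier histories `Carriers.Hist S.P` and its trivial history is `Hist.triv` (definitional).
[cite: Balaban1985UV3, (38)–(40) p.266] -/
theorem triv_towerOfAC_eq (k : ℕ) : (towerOfAC 𝔎 X 𝔖).triv k = Hist.triv S.P k := rfl

end Summit.QuantumFields.Balaban3D.Proofs.TowerFactsAC

end
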